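import Summits.QuantumFields.YangMills.Theorems.BalabanUVNodesN18UniformDecayOfStepRate

/-!
# BalabanUVNodes ∕ N18 — ONE MEMBER GENERATES THE WINDOW: FILE 6's LEVEL-0 ROW (and with (J1) the whole N18 ∕ (D4) kernel side) FROM THE DATA AT ONE
# COUPLING VALUE `b₀` + node N22's NE9 LETTER (Track A, DAG node N18 = NE5 `T4OutputRate.NE5`; cluster K4 «SpineRates»; key K3⁷ `SpineGivenEndpointR13SepCoPH`
# = stmt-QuantumFields-20544, skeleton v5 941dddb108cbaacf; width seat `pub-ymgap-dag-n18-w4` g4, FILE 8 of the seat's kernel-currency lineage; imports FILE 5 only —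
# outside the Theses cone; `--kind proof --supports stmt-QuantumFields-20544 --as helper`, COUNT-NEUTRAL)

HONEST FRAMING.  Junction lemmas in HYPOTHESIS FORM.  dag-n18-w1's (J1) (`…N18AtU3OfKernels.kernelStepRate_family_of_member`,
`…N18KernelLettersJunctions.kernelStepRateOfRecord₁₃_of_member_of_windowedNE9OfRecord₁₃`) showed that node N18's step-rate letter at EVERY member `b ∈ ]0, γ]` follows from
the step rate at ONE member `b₀` and node N22's NE9 letter (history-Lipschitz kernels with fading-memory moduli).  FILES 5–7 of this lineage reduced the k-uniform decay rows
((UD), (D4)'s `hdec` ∕ `hW`) to the step-rate letter + ONE LEVEL-0 ROW (the first RG step's kernel decay, uniform over the window).  THIS FILE is (J1)'s twin for that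
level-0 row: NE9 AT LEVEL 0 is a Lipschitz bound in the first coupling `g_0` with a DECAYING modulus `e^{−κ|z|₁} Λ 1 0 |g_0 − g_0'|`, so the level-0 decay AT ONE MEMBER
`b₀` gives the level-0 row at every `g ∈ ]0, γ]^ℕ` with constant `E₀ + Λ 1 0·γ` (§1).  Consequently (§1 ★, §2 ★) the N18 ∕ (D4) kernel side of K3⁷'s bills reads, GIVEN
node N22's NE9 letter and (1.21)-existence: ONE member `b₀`, the step rate AT `b₀` (all levels) and the level-0 decay AT `b₀` — the rest of the window is generated by NE9.
The one-member rows ARE N18-type estimates (at one coupling value), asserted nowhere; every letter is a DISPLAYED HYPOTHESIS inhabited for no family of record (K0⁷ OPEN);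
nothing of Bałaban is asserted; NE5 ∕ NE9 ∕ (5.10) for d = 4 NOT PRINTED as such ∕ NOT proved; N18 ∕ N22 ∕ (D4) NOT discharged; K3⁷ OPEN, not claimed; skeleton v5
UNTOUCHED; counts unmoved (typed 28∕28 · discharged 5∕28).  One finite four-torus programme at fixed ε — R4 closes the CONDITIONAL rung `BalabanLadder.UV` only; nothing
continuum ∕ ℝ⁴ ∕ OS ∕ mass gap ∕ Clay; no summit statement is proved by this seat.  THEOREMS ONLY: 0 `def`, 0 `sorry`, standard axioms.

CONTENTS.
§1 generic term family `ℰ`: `const_mem_window` · ★ `baseRowLimit_of_member_of_ne9` · `baseRow_of_member_of_windowedNE9` (windowed twin, eventually in `K`) ·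
★ `decayBound_EA_of_member_of_ne9` ((J1) ∘ FILE 5 §2 ∘ §1: ONE member's step rate + ONE member's level-0 decay + NE9 ⟹ W1-19's `DecayBound (EA …) (Window γ) … κ`).
§2 at the record, guarded shapes (dag-n27's `…N27AtKernelPinnedReading13CoPHLetters` binders; any `N`, regime `Rg`): `kernelStepRateOfRecord₁₃_guarded_of_member` ((J1)'s record
edition, guarded: the bills' `h18` row) · `baseRowLimit_guarded_of_member` (FILE 6's `h0L` row shape: the two substitutions turn FILE 6's limit bill ∕ stub-1 text into ONE-member statements)
· ★ `kernelDecayOfRecord₁₃_guarded_of_member` (the bills' `hdec` — and `hW` through FILE 7 — from ONE member's data + `hL h9`, every direction pair).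

Sources (TYPES only): T. Bałaban, Commun. Math. Phys. **109** (1987) 249–301 [Balaban1987RG1] — Thm 1 p. 259, (1.18) p. 263, (1.20)–(1.21) p. 264, (5.10) p. 293, §5 p. 298
(«β_j depends also on all preceding coupling constants»).  No claim about the mass gap.
-/

set_option autoImplicit false

noncomputable section

open Filter Topology
open scoped BigOperators Matrix.Norms.L2Operator

namespace YMDAG.N18.BaseRowOfMember

open Literature.MathematicalPhysics.QuantumFieldTheory.Balaban1983to89
open Literature.MathematicalPhysics.QuantumFieldTheory.Balaban1983to89.T4Continuum (T4Family)
open Literature.MathematicalPhysics.QuantumFieldTheory.Balaban1983to89.T4OutputRate (Window DecayBound NE9 FadingMemory mem_window)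
open Literature.MathematicalPhysics.QuantumFieldTheory.Balaban1983to89.B12Sec2to5 (l1 Decay510)
open Node00 (TermFamily1 polWindow Stage13Params Stage13HParams U3Letters₁₁ prependCoupling mergedTermFamilyMatT TβOfRecord₁₃ chiβOfRecord₁₃)
open Node00.U3OfKernels (histPrefix kernelA EA ne9_EA_iff KernelDecayOfRecord₁₃)
open Node00.U3KernelLetters (KernelStepRate WindowedNE9 PolLimitsExist kernelStepRate_iff KernelStepRateOfRecord₁₃ WindowedNE9OfRecord₁₃ PolLimitsExistOfRecord₁₃)
open YMDAG.N18.AtU3OfKernels (kernelStepRate_family_of_member)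
open YMDAG.N18.KernelLettersJunctions (kernelStepRateOfRecord₁₃_of_member_of_windowedNE9OfRecord₁₃)
open YMDAG.N18.UniformDecayOfStepRate (decayBound_EA_of_kernelStepRate_of_base kernelDecayOfRecord₁₃_of_kernelStepRateOfRecord₁₃_of_base)
open YMDAG.N22.AtKernels (ne9_EA_of_windowed)

/-! ## §1 Generic term family: the level-0 row at every sequence of the window from ONE member + NE9 at level 0 -/

section Generic

variable {𝔄 : Type*} [NormedRing 𝔄] [NormedAlgebra ℝ 𝔄]
variable {V : Type*} [NormedAddCommGroup V] [NormedSpace ℝ V] {ι : Type*} [Fintype ι]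
variable (F : T4Family) {ℰ : TermFamily1 F 𝔄} (ρ : V →L[ℝ] 𝔄) (bV : Module.Basis ι ℝ V)

/-- The constant sequence at a member `b₀ ∈ ]0, γ]` lies in the window. [cite: Balaban1987RG1, Thm 1 p.259 (bookkeeping)] -/
theorem const_mem_window {γ b₀ : ℝ} (hb₀ : 0 < b₀) (hb₀γ : b₀ ≤ γ) : (fun _ : ℕ => b₀) ∈ Window γ :=
  mem_window.2 fun _ => ⟨hb₀, hb₀γ⟩

/-- ★ **THE LIMIT LEVEL-0 ROW AT EVERY SEQUENCE FROM ONE MEMBER + NE9**: W1-19's `NE9 (EA F ℰ ρ bV) (Window γ) κ Λ` at level `0` is the Lipschitz bound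
`|Π_1(g_0; z) − Π_1(g_0'; z)| ≤ e^{−κ|z|₁} Λ 1 0 |g_0 − g_0'|`; with `0 ≤ Λ 1 0`, a member `b₀ ∈ ]0, γ]` and the level-0 (5.10) class AT `b₀` (`Decay510 (Π_1(b₀; ·)) E₀ κ`) every
`g ∈ ]0, γ]^ℕ` has `Decay510 (Π_1(g_0; ·)) (E₀ + Λ 1 0·γ) κ` — FILE 6's limit level-0 row `h0ᴸ`. [cite: Balaban1987RG1, (1.18) p.263, (5.10) p.293 and §5 p.298 (shape; nothing of the source asserted)] -/
theorem baseRowLimit_of_member_of_ne9 {γ κ E₀ : ℝ} {Λ : ℕ → ℕ → ℝ} (h9 : NE9 (EA F ℰ ρ bV) (Window γ) κ Λ) (hΛ : 0 ≤ Λ 1 0)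
    {b₀ : ℝ} (hb₀ : 0 < b₀) (hb₀γ : b₀ ≤ γ) (h0 : ∀ μ ν : Fin 4, Decay510 (kernelA F ℰ ρ bV (fun _ => b₀) 0 μ ν) E₀ κ) :
    ∀ g ∈ Window γ, ∀ μ ν : Fin 4, Decay510 (kernelA F ℰ ρ bV g 0 μ ν) (E₀ + Λ 1 0 * γ) κ := by
  intro g hg μ ν z
  have hL := (ne9_EA_iff F ℰ ρ bV (Window γ) κ Λ).1 h9 g hg (fun _ => b₀) (const_mem_window hb₀ hb₀γ) 0 μ ν z
  simp only [zero_add, Finset.sum_range_one] at hL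
  have hg0 := mem_window.1 hg 0
  have hd : |g 0 - b₀| ≤ γ := by   -- two members of `]0, γ]` (the Erice junction's `abs_sub_le_of_mem_Ioc`, inlined)
    rw [abs_sub_le_iff]; constructor <;> linarith [hg0.1, hg0.2]
  have he : Real.exp (-(κ * l1 z)) = Real.exp (-κ * l1 z) := by rw [neg_mul]
  rw [he] at hL
  calc |kernelA F ℰ ρ bV g 0 μ ν z|
      = |kernelA F ℰ ρ bV (fun _ => b₀) 0 μ ν z + (kernelA F ℰ ρ bV g 0 μ ν z - kernelA F ℰ ρ bV (fun _ => b₀) 0 μ ν z)| := by rw [add_sub_cancel]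
    _ ≤ |kernelA F ℰ ρ bV (fun _ => b₀) 0 μ ν z| + |kernelA F ℰ ρ bV g 0 μ ν z - kernelA F ℰ ρ bV (fun _ => b₀) 0 μ ν z| := abs_add_le _ _
    _ ≤ E₀ * Real.exp (-κ * l1 z) + Real.exp (-κ * l1 z) * (Λ 1 0 * |g 0 - b₀|) := add_le_add (h0 μ ν z) hL
    _ ≤ E₀ * Real.exp (-κ * l1 z) + Real.exp (-κ * l1 z) * (Λ 1 0 * γ) :=
        add_le_add le_rfl (mul_le_mul_of_nonneg_left (mul_le_mul_of_nonneg_left hd hΛ) (Real.exp_nonneg _))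
    _ = (E₀ + Λ 1 0 * γ) * Real.exp (-κ * l1 z) := by ring

/-- **THE WINDOWED LEVEL-0 ROW AT EVERY SEQUENCE FROM ONE MEMBER + WINDOWED NE9** (finite volume, eventually in `K`): W1-19b's `WindowedNE9 F ℰ ρ bV (Window γ) κ Λ` at
level `0`, `0 ≤ Λ 1 0`, a member `b₀ ∈ ]0, γ]` and the windowed level-0 bound AT `b₀` give FILE 6's windowed level-0 row `h0` at every `g ∈ ]0, γ]^ℕ` with constant `E₀ + Λ 1 0·γ`.
[cite: Balaban1987RG1, (1.18) p.263, (1.20) p.264 and (5.10) p.293 (shape; nothing of the source asserted)] -/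
theorem baseRow_of_member_of_windowedNE9 {γ κ E₀ : ℝ} {Λ : ℕ → ℕ → ℝ} (h9 : WindowedNE9 F ℰ ρ bV (Window γ) κ Λ) (hΛ : 0 ≤ Λ 1 0)
    {b₀ : ℝ} (hb₀ : 0 < b₀) (hb₀γ : b₀ ≤ γ)
    (h0 : ∀ (μ ν : Fin 4) (z : Fin 4 → ℤ), ∀ᶠ K in atTop,
      |polWindow F K 1 (ℰ 0 (histPrefix (fun _ => b₀) 0) K) ρ bV μ ν z| ≤ E₀ * Real.exp (-κ * l1 z)) :
    ∀ g ∈ Window γ, ∀ (μ ν : Fin 4) (z : Fin 4 → ℤ), ∀ᶠ K in atTop,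
      |polWindow F K 1 (ℰ 0 (histPrefix g 0) K) ρ bV μ ν z| ≤ (E₀ + Λ 1 0 * γ) * Real.exp (-κ * l1 z) := by
  intro g hg μ ν z
  have hg0 := mem_window.1 hg 0
  have hd : |g 0 - b₀| ≤ γ := by
    rw [abs_sub_le_iff]; constructor <;> linarith [hg0.1, hg0.2]
  filter_upwards [h9 g hg (fun _ => b₀) (const_mem_window hb₀ hb₀γ) 0 μ ν z, h0 μ ν z] with K hK h0K
  simp only [Finset.sum_range_one, zero_add] at hK
  rw [← neg_mul] at hK
  calc |polWindow F K 1 (ℰ 0 (histPrefix g 0) K) ρ bV μ ν z|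
      = |polWindow F K 1 (ℰ 0 (histPrefix (fun _ => b₀) 0) K) ρ bV μ ν z +
          (polWindow F K 1 (ℰ 0 (histPrefix g 0) K) ρ bV μ ν z - polWindow F K 1 (ℰ 0 (histPrefix (fun _ => b₀) 0) K) ρ bV μ ν z)| := by
        rw [add_sub_cancel]
    _ ≤ |polWindow F K 1 (ℰ 0 (histPrefix (fun _ => b₀) 0) K) ρ bV μ ν z| +
          |polWindow F K 1 (ℰ 0 (histPrefix g 0) K) ρ bV μ ν z - polWindow F K 1 (ℰ 0 (histPrefix (fun _ => b₀) 0) K) ρ bV μ ν z| := abs_add_le _ _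
    _ ≤ E₀ * Real.exp (-κ * l1 z) + Real.exp (-κ * l1 z) * (Λ 1 0 * |g 0 - b₀|) := add_le_add h0K hK
    _ ≤ E₀ * Real.exp (-κ * l1 z) + Real.exp (-κ * l1 z) * (Λ 1 0 * γ) :=
        add_le_add le_rfl (mul_le_mul_of_nonneg_left (mul_le_mul_of_nonneg_left hd hΛ) (Real.exp_nonneg _))
    _ = (E₀ + Λ 1 0 * γ) * Real.exp (-κ * l1 z) := by ring

/-- ★ **W1-19's DECAY SLOT FROM ONE MEMBER's DATA + NE9** ((J1) ∘ FILE 5 §2 ∘ `baseRowLimit_of_member_of_ne9`): `NE9 (EA …) (Window γ) κ Λ` with fading-memory moduli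
(`FadingMemory C₉ ω Λ`, `0 ≤ ω ≤ θ < 1`), ONE member `b₀ ∈ ]0, γ]` carrying the kernel step rate at every level (constant `C₅ ≥ 0`) AND the level-0 (5.10) class (constant `E₀`)
give `DecayBound (EA F ℰ ρ bV) (Window γ) (E₀ + Λ 1 0·γ + (C₅ + C₉γ)·(θ∕(1−θ))) κ` — the (UD) input of node N17's kernel road and, per direction pair, (D4)'s (5.10) class.
[cite: Balaban1987RG1, Thm 1 p.259, (1.18) p.263, (5.10) p.293 and §5 p.298 (mechanism; nothing of the source asserted)] -/
theorem decayBound_EA_of_member_of_ne9 {γ κ C₉ ω θ C₅ E₀ : ℝ} {Λ : ℕ → ℕ → ℝ} (h9 : NE9 (EA F ℰ ρ bV) (Window γ) κ Λ) (hΛ : FadingMemory C₉ ω Λ)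
    (hω0 : 0 ≤ ω) (hωθ : ω ≤ θ) (hθ1 : θ < 1) (hC₅ : 0 ≤ C₅) (hγ : 0 ≤ γ) {b₀ : ℝ} (hb₀ : 0 < b₀) (hb₀γ : b₀ ≤ γ)
    (h5 : ∀ g ∈ Window γ, ∀ (k : ℕ) (μ ν : Fin 4) (z : Fin 4 → ℤ),
      |kernelA F ℰ ρ bV g k μ ν z - kernelA F ℰ ρ bV (prependCoupling b₀ g) (k + 1) μ ν z| ≤ C₅ * θ ^ (k + 1) * Real.exp (-(κ * l1 z)))
    (h0 : ∀ μ ν : Fin 4, Decay510 (kernelA F ℰ ρ bV (fun _ => b₀) 0 μ ν) E₀ κ) :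
    DecayBound (EA F ℰ ρ bV) (Window γ) (E₀ + Λ 1 0 * γ + (C₅ + C₉ * γ) * (θ / (1 - θ))) κ := by
  have hC₉ : 0 ≤ C₉ := by
    have h := hΛ 0 0 le_rfl
    simpa using h.1.trans h.2
  have h18 : KernelStepRate F ℰ ρ bV γ κ θ (C₅ + C₉ * γ) :=
    (kernelStepRate_iff F ℰ ρ bV γ κ θ _).2
      (kernelStepRate_family_of_member F ℰ ρ bV ((ne9_EA_iff F ℰ ρ bV _ κ Λ).1 h9) hΛ hω0 hωθ hθ1.le hb₀ hb₀γ h5)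
  exact decayBound_EA_of_kernelStepRate_of_base F ρ bV (hω0.trans hωθ) hθ1 (add_nonneg hC₅ (mul_nonneg hC₉ hγ)) h18
    (baseRowLimit_of_member_of_ne9 F ρ bV h9 (hΛ 1 0 zero_le_one).1 hb₀ hb₀γ h0)

end Generic

/-! ## §2 At the record, guarded shapes: the bills' `h18` and `hdec` rows from ONE member's data + `hL h9` -/

section Guarded

variable {N : ℕ} [NeZero N] (Rg : (F : T4Family) → Stage13HParams F N → Prop)
  (ℓ : (F : T4Family) → Stage13HParams F N → U3Letters₁₁) (b₀ E₀ : (F : T4Family) → Stage13HParams F N → ℝ)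

/-- **THE BILLS' N18 ROW `h18`, GUARDED, FROM ONE MEMBER + node N22's LETTERS OF RECORD** ((J1)'s record edition, dag-n18-w1, keyed `∀ F θ, Provisos₁₃CoPH → Rg → Admissible → …`):
signs `hs`, `hωθ : (ℓ F θ).ω ≤ (ℓ F θ).θ₅`, `hL`, `h9`, a member `b₀ F θ ∈ ]0, θ.γ]` and the kernel step rate of the merged term of record AT `b₀ F θ` (constant `(ℓ F θ).C₅ − (ℓ F θ).C₉·θ.γ`)
give `KernelStepRateOfRecord₁₃ F N θ (ℓ F θ).κ (ℓ F θ).θ₅ (ℓ F θ).C₅`. [cite: Balaban1987RG1, Thm 1 p.259, (1.21) p.264 and §5 p.298 (shape; nothing of the record asserted)] -/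
theorem kernelStepRateOfRecord₁₃_guarded_of_member
    (hs : ∀ (F : T4Family) (θ : Stage13HParams F N), θ.Provisos₁₃CoPH F N → Rg F θ → θ.Admissible F N → (ℓ F θ).Signs)
    (hωθ : ∀ (F : T4Family) (θ : Stage13HParams F N), θ.Provisos₁₃CoPH F N → Rg F θ → θ.Admissible F N → (ℓ F θ).ω ≤ (ℓ F θ).θ₅)
    (hL : ∀ (F : T4Family) (θ : Stage13HParams F N), θ.Provisos₁₃CoPH F N → Rg F θ → θ.Admissible F N → PolLimitsExistOfRecord₁₃ F N θ.toStage13Params)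
    (h9 : ∀ (F : T4Family) (θ : Stage13HParams F N), θ.Provisos₁₃CoPH F N → Rg F θ → θ.Admissible F N →
      WindowedNE9OfRecord₁₃ F N θ.toStage13Params (ℓ F θ).κ (ℓ F θ).moduli)
    (hb₀ : ∀ (F : T4Family) (θ : Stage13HParams F N), θ.Provisos₁₃CoPH F N → Rg F θ → θ.Admissible F N → 0 < b₀ F θ ∧ b₀ F θ ≤ θ.γ)
    (h5 : ∀ (F : T4Family) (θ : Stage13HParams F N), θ.Provisos₁₃CoPH F N → Rg F θ → θ.Admissible F N →
      letI := θ.instVβ₁; letI := θ.instVβ₂; letI := θ.instιβ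
      ∀ g ∈ Window θ.γ, ∀ (k : ℕ) (μ ν : Fin 4) (z : Fin 4 → ℤ),
        |kernelA F (mergedTermFamilyMatT F N (TβOfRecord₁₃ F N) (chiβOfRecord₁₃ F N θ.toStage13Params) θ.εbg) θ.ρ8 θ.bV g k μ ν z -
            kernelA F (mergedTermFamilyMatT F N (TβOfRecord₁₃ F N) (chiβOfRecord₁₃ F N θ.toStage13Params) θ.εbg) θ.ρ8 θ.bV (prependCoupling (b₀ F θ) g) (k + 1) μ ν z| ≤
          ((ℓ F θ).C₅ - (ℓ F θ).C₉ * θ.γ) * (ℓ F θ).θ₅ ^ (k + 1) * Real.exp (-((ℓ F θ).κ * l1 z))) :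
    ∀ (F : T4Family) (θ : Stage13HParams F N), θ.Provisos₁₃CoPH F N → Rg F θ → θ.Admissible F N →
      KernelStepRateOfRecord₁₃ F N θ.toStage13Params (ℓ F θ).κ (ℓ F θ).θ₅ (ℓ F θ).C₅ :=
  fun F θ hP hRg hθ => kernelStepRateOfRecord₁₃_of_member_of_windowedNE9OfRecord₁₃ F N θ.toStage13Params (ℓ F θ) (hs F θ hP hRg hθ) (hωθ F θ hP hRg hθ)
    (hL F θ hP hRg hθ) (h9 F θ hP hRg hθ) (hb₀ F θ hP hRg hθ).1 (hb₀ F θ hP hRg hθ).2 (h5 F θ hP hRg hθ)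

/-- **FILE 6's LIMIT LEVEL-0 ROW `h0ᴸ`, GUARDED, FROM ONE MEMBER + `hL h9`**: signs, (1.21)-existence and node N22's windowed NE9 letter of record (⟹ NE9 of the limiting kernels,
dag-n22-w3's `ne9_EA_of_windowed`), a member `b₀ F θ ∈ ]0, θ.γ]` and the level-0 (5.10) class AT that member give the level-0 row at EVERY sequence of the window with constant
`E₀ F θ + (ℓ F θ).moduli 1 0·θ.γ` — exactly the `h0L` row of FILE 6's `keyedRatesHolderD4_rrOfRecord_of_pins_of_limitLetters_of_base` ∕ `stub1Text_of_limitLetters_of_base` (at `N = 2`,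
`Rg := ZhUnity ∧ SlotsNondegenerate₁₃`), so those read ONE member's data by two substitutions (`h18 :=` `kernelStepRateOfRecord₁₃_guarded_of_member`, `h0L :=` this).
[cite: Balaban1987RG1, (1.18) p.263, (1.21) p.264 and (5.10) p.293 (shape; nothing of the record asserted)] -/
theorem baseRowLimit_guarded_of_member
    (hs : ∀ (F : T4Family) (θ : Stage13HParams F N), θ.Provisos₁₃CoPH F N → Rg F θ → θ.Admissible F N → (ℓ F θ).Signs)
    (hL : ∀ (F : T4Family) (θ : Stage13HParams F N), θ.Provisos₁₃CoPH F N → Rg F θ → θ.Admissible F N → PolLimitsExistOfRecord₁₃ F N θ.toStage13Params)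
    (h9 : ∀ (F : T4Family) (θ : Stage13HParams F N), θ.Provisos₁₃CoPH F N → Rg F θ → θ.Admissible F N →
      WindowedNE9OfRecord₁₃ F N θ.toStage13Params (ℓ F θ).κ (ℓ F θ).moduli)
    (hb₀ : ∀ (F : T4Family) (θ : Stage13HParams F N), θ.Provisos₁₃CoPH F N → Rg F θ → θ.Admissible F N → 0 < b₀ F θ ∧ b₀ F θ ≤ θ.γ)
    (h0 : ∀ (F : T4Family) (θ : Stage13HParams F N), θ.Provisos₁₃CoPH F N → Rg F θ → θ.Admissible F N →
      letI := θ.instVβ₁; letI := θ.instVβ₂; letI := θ.instιβ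
      ∀ μ ν : Fin 4, Decay510 (kernelA F (mergedTermFamilyMatT F N (TβOfRecord₁₃ F N) (chiβOfRecord₁₃ F N θ.toStage13Params) θ.εbg) θ.ρ8 θ.bV
        (fun _ => b₀ F θ) 0 μ ν) (E₀ F θ) (ℓ F θ).κ) :
    ∀ (F : T4Family) (θ : Stage13HParams F N), θ.Provisos₁₃CoPH F N → Rg F θ → θ.Admissible F N →
      letI := θ.toStage13Params.instVβ₁; letI := θ.toStage13Params.instVβ₂; letI := θ.toStage13Params.instιβ
      ∀ g ∈ Window θ.toStage13Params.γ, ∀ (μ ν : Fin 4),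
        Decay510 (kernelA F (mergedTermFamilyMatT F N (TβOfRecord₁₃ F N) (chiβOfRecord₁₃ F N θ.toStage13Params) θ.toStage13Params.εbg)
          θ.toStage13Params.ρ8 θ.toStage13Params.bV g 0 μ ν) (E₀ F θ + (ℓ F θ).moduli 1 0 * θ.toStage13Params.γ) (ℓ F θ).κ := by
  intro F θ hP hRg hθ
  letI := θ.instVβ₁; letI := θ.instVβ₂; letI := θ.instιβ
  exact baseRowLimit_of_member_of_ne9 F θ.ρ8 θ.bV (ne9_EA_of_windowed F _ θ.ρ8 θ.bV (hL F θ hP hRg hθ) (h9 F θ hP hRg hθ))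
    ((hs F θ hP hRg hθ).moduli_nonneg 1 0) (hb₀ F θ hP hRg hθ).1 (hb₀ F θ hP hRg hθ).2 (h0 F θ hP hRg hθ)

/-- ★ **THE BILLS' (D4) ROW `hdec`, GUARDED, FROM ONE MEMBER's DATA + `hL h9`**: the rows of `kernelStepRateOfRecord₁₃_guarded_of_member` AND the level-0 (5.10) class of the merged term of
record AT the member `b₀ F θ` (constant `E₀ F θ`) give `KernelDecayOfRecord₁₃ F N θ μ ν (ℓ F θ).κ` in EVERY direction pair — dag-n27-c's `hdec` at `(0,1)`, and dag-n27-w1's `hW` by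
FILE 7's `windowedDecayOfRecord₁₃_of_kernelDecayOfRecord₁₃`.  Road: (J1) ⟹ the step-rate letter; NE9 of the limiting kernels (dag-n22-w3's `ne9_EA_of_windowed` from `hL h9`) ⟹ §1 the level-0 row
at every sequence; FILE 5 §5.  So, GIVEN node N22's letter and (1.21)-existence, the N18 ∕ (D4) kernel side of K3⁷'s bills reads: ONE member, the step rate AT it, the level-0 decay AT it.
[cite: Balaban1987RG1, Thm 1 p.259, (1.18) p.263, (1.21) p.264, (5.10) p.293 and §5 p.298 (mechanism; nothing of the record asserted)] -/
theorem kernelDecayOfRecord₁₃_guarded_of_member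
    (hs : ∀ (F : T4Family) (θ : Stage13HParams F N), θ.Provisos₁₃CoPH F N → Rg F θ → θ.Admissible F N → (ℓ F θ).Signs)
    (hωθ : ∀ (F : T4Family) (θ : Stage13HParams F N), θ.Provisos₁₃CoPH F N → Rg F θ → θ.Admissible F N → (ℓ F θ).ω ≤ (ℓ F θ).θ₅)
    (hL : ∀ (F : T4Family) (θ : Stage13HParams F N), θ.Provisos₁₃CoPH F N → Rg F θ → θ.Admissible F N → PolLimitsExistOfRecord₁₃ F N θ.toStage13Params)
    (h9 : ∀ (F : T4Family) (θ : Stage13HParams F N), θ.Provisos₁₃CoPH F N → Rg F θ → θ.Admissible F N →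
      WindowedNE9OfRecord₁₃ F N θ.toStage13Params (ℓ F θ).κ (ℓ F θ).moduli)
    (hb₀ : ∀ (F : T4Family) (θ : Stage13HParams F N), θ.Provisos₁₃CoPH F N → Rg F θ → θ.Admissible F N → 0 < b₀ F θ ∧ b₀ F θ ≤ θ.γ)
    (h5 : ∀ (F : T4Family) (θ : Stage13HParams F N), θ.Provisos₁₃CoPH F N → Rg F θ → θ.Admissible F N →
      letI := θ.instVβ₁; letI := θ.instVβ₂; letI := θ.instιβ
      ∀ g ∈ Window θ.γ, ∀ (k : ℕ) (μ ν : Fin 4) (z : Fin 4 → ℤ),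
        |kernelA F (mergedTermFamilyMatT F N (TβOfRecord₁₃ F N) (chiβOfRecord₁₃ F N θ.toStage13Params) θ.εbg) θ.ρ8 θ.bV g k μ ν z -
            kernelA F (mergedTermFamilyMatT F N (TβOfRecord₁₃ F N) (chiβOfRecord₁₃ F N θ.toStage13Params) θ.εbg) θ.ρ8 θ.bV (prependCoupling (b₀ F θ) g) (k + 1) μ ν z| ≤
          ((ℓ F θ).C₅ - (ℓ F θ).C₉ * θ.γ) * (ℓ F θ).θ₅ ^ (k + 1) * Real.exp (-((ℓ F θ).κ * l1 z)))
    (h0 : ∀ (F : T4Family) (θ : Stage13HParams F N), θ.Provisos₁₃CoPH F N → Rg F θ → θ.Admissible F N →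
      letI := θ.instVβ₁; letI := θ.instVβ₂; letI := θ.instιβ
      ∀ μ ν : Fin 4, Decay510 (kernelA F (mergedTermFamilyMatT F N (TβOfRecord₁₃ F N) (chiβOfRecord₁₃ F N θ.toStage13Params) θ.εbg) θ.ρ8 θ.bV
        (fun _ => b₀ F θ) 0 μ ν) (E₀ F θ) (ℓ F θ).κ) :
    ∀ (F : T4Family) (θ : Stage13HParams F N), θ.Provisos₁₃CoPH F N → Rg F θ → θ.Admissible F N → ∀ μ ν : Fin 4,
      KernelDecayOfRecord₁₃ F N θ.toStage13Params μ ν (ℓ F θ).κ := by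
  intro F θ hP hRg hθ μ ν
  letI := θ.instVβ₁; letI := θ.instVβ₂; letI := θ.instιβ
  have hsg := hs F θ hP hRg hθ
  have h18 := kernelStepRateOfRecord₁₃_guarded_of_member Rg ℓ b₀ hs hωθ hL h9 hb₀ h5 F θ hP hRg hθ
  have hne9 := ne9_EA_of_windowed F _ θ.ρ8 θ.bV (hL F θ hP hRg hθ) (h9 F θ hP hRg hθ)
  have hΛ : 0 ≤ (ℓ F θ).moduli 1 0 := hsg.moduli_nonneg 1 0
  exact kernelDecayOfRecord₁₃_of_kernelStepRateOfRecord₁₃_of_base F N θ.toStage13Params hsg.θ₅_pos.le hsg.θ₅_lt_one hsg.C₅_nonneg h18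
    (baseRowLimit_of_member_of_ne9 F θ.ρ8 θ.bV hne9 hΛ (hb₀ F θ hP hRg hθ).1 (hb₀ F θ hP hRg hθ).2 (h0 F θ hP hRg hθ)) μ ν

end Guarded

end YMDAG.N18.BaseRowOfMember

end
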